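import Summits.PneNP.PneNP.Theorems.UniformStreamLB.Negative.UniformMachines
import Summits.PneNP.PneNP.Theorems.UniformMagnification.Negative.UniformClassWitness
import Literature.Computability.Complexity.TM2PassThrough
import Literature.Computability.Complexity.StackWordArith

/-!
# `UniformStreamLB` (crux stmt-PneNP-16045, route `UniformStream`) — negative-side support, part 2/2:
# the generic machines of part 1 inhabit the uniform streaming class at EVERY budget `≥ ⌊log₂N⌋+1`,
# and the crux's witness `s` must dip below the universal bound (refuter crux-attack seat; no refutation)

Companion of `UniformMachines.lean` (part 1: the honest uniform `TM2` machine family `dfaMachine`) and of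
the sibling seat's `UniformMagnification/Negative/UniformClassWitness.lean` (whose
`MCSPSize_eq_setOf_pow_two` and budget-`s(⌊log₂N⌋)^c + c` witness we REUSE rather than restate).
Sorry-free:

* `uniformClass_pow2 S` — for EVERY budget function `S` with `S N ≥ ⌊log₂ N⌋ + 1` (not only the
  shapes `s(⌊log₂N⌋)^c + c`, `c ≥ 3`) the four resource conjuncts of the crux are met by ONE
  `dfaMachine` each for init / update / accept, deciding `{x | |x| = 2^k}` (init: the 3-state automaton
  `δpow` on the numeral of `N`; update / accept: the 6-symbol absorber `δ6`; every machine halts within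
  `|input| / 8 + 1 ≤ S N` steps; constant-size states, so the N-blind update/accept machines and the
  "budget re-reads the state" convention cost nothing here).
* `uniformStreamLB_matrix_false_of_univBound_le` — for every `s ≥ univBound` (no growth hypothesis
  needed: `n ≤ univBound n`) the matrix `∀ c, ¬ ∃ …` of the crux FAILS already at `c = 1`;
  `witness_lt_univBound`, `uniformStreamLB_witness_shape` — read off the crux BY NAME: any witness `s`
  of `UniformStreamLB` is time constructible AND has `s n < univBound n = 5·2ⁿ - 4` for some `n`.

With part 3 (`VacuousWithoutTC.lean`: without `n ≤ s n` the crux is vacuously true at `s = 0`) this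
brackets the crux: its content lives in the window `n ≤ s n`, `s ≯ univBound` — the
McKay–Murray–Williams (STOC 2019, Thm. 1.3, p. 3) regime; nothing is true or false for a silly reason.
-/

noncomputable section

set_option linter.dupNamespace false

open Turing Computability
open Literature.Computability.Complexity Literature.Computability.MetaComplexity

namespace Summit.PneNP.PneNP.Theorems.UniformStreamLB.Negative

/-! ### The uniform streaming algorithm for `{x | |x| is a power of two}` -/

section Pow2

/-- init output: `[1]` on numerals of powers of two, else `[]`. [folklore] -/
def outInit (q : Q3) : List Bool := if q = .hit then [true] else []

/-- update output on (the absorbed prefix of) `boolPair st [b]`: `[1]` iff `st = [1]`. [folklore] -/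
def outUpd (v : Q6) : List Bool :=
  if v.1.length = 5 ∧ v.1.take 4 = [true, true, false, true] then [true] else []

/-- accept bit on (the absorbed prefix of) the final state: is it `[1]`? [folklore] -/
def accBit (v : Q6) : Bool := decide (v.1 = [true])

/-- The algorithm: state `[1]` if the announced length is a power of two, else `[]`; updates keep it. [folklore] -/
def pow2Alg : StreamingAlgorithm where
  init N := outInit ((encodeNat N).foldl δpow .zeros)
  update _ st b := outUpd ((boolPair st [b]).foldl δ6 q6)
  accept _ st := accBit (st.foldl δ6 q6)

/-- The init machine flags exactly the powers of two. [folklore] -/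
theorem outInit_eq (N : ℕ) :
    outInit ((encodeNat N).foldl δpow .zeros) = if N = 2 ^ Nat.log 2 N then [true] else [] := by
  unfold outInit
  congr 1
  refine propext ((foldl_δpow_zeros _).trans ⟨?_, fun h => ⟨Nat.log 2 N, ?_⟩⟩)
  · rintro ⟨k, hk⟩
    rw [← Com.encodeNat_two_pow] at hk
    have hN : N = 2 ^ k := by simpa using congrArg decodeNat hk
    rw [hN, Nat.log_pow (by norm_num)]
  · rw [← Com.encodeNat_two_pow, ← h]

/-- The update machine keeps the state `[1]` and clears everything else. [folklore] -/
theorem outUpd_eq (st : List Bool) (b : Bool) :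
    outUpd ((boolPair st [b]).foldl δ6 q6) = if st = [true] then [true] else [] := by
  unfold outUpd
  rw [foldl_δ6_q6]
  rcases st with _ | ⟨v, _ | ⟨v', rest⟩⟩
  · simp [boolPair]
  · cases v <;> cases b <;> simp [boolPair]
  · have hlen : ((boolPair (v :: v' :: rest) [b]).take 6).length = 6 := by
      rw [List.length_take, length_boolPair]
      simp only [List.length_cons, List.length_nil]
      omega
    rw [if_neg (by rw [hlen]; simp), if_neg (by simp)]

/-- The accept machine tests the state against `[1]`. [folklore] -/
theorem accBit_eq (st : List Bool) : accBit (st.foldl δ6 q6) = decide (st = [true]) := by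
  unfold accBit
  rw [foldl_δ6_q6]
  by_cases h : st.length ≤ 6
  · rw [List.take_of_length_le h]
  · have hne : st.take 6 ≠ [true] := fun h' => by
      have := congrArg List.length h'; simp at this; omega
    have hne' : st ≠ [true] := by rintro rfl; simp at h
    simp [hne, hne']

/-- `init` of the algorithm. [folklore] -/
theorem pow2Alg_init (N : ℕ) : pow2Alg.init N = if N = 2 ^ Nat.log 2 N then [true] else [] :=
  outInit_eq N

/-- `update` of the algorithm. [folklore] -/
theorem pow2Alg_update (N : ℕ) (st : List Bool) (b : Bool) :
    pow2Alg.update N st b = if st = [true] then [true] else [] :=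
  outUpd_eq st b

/-- The run never changes the initial state. [folklore] -/
theorem pow2Alg_foldl (N : ℕ) (x st : List Bool) (hst : st = [true] ∨ st = []) :
    x.foldl (pow2Alg.update N) st = st := by
  induction x generalizing st with
  | nil => rfl
  | cons b x ih =>
    rw [List.foldl_cons, pow2Alg_update]
    rcases hst with rfl | rfl
    · rw [if_pos rfl]; exact ih _ (Or.inl rfl)
    · rw [if_neg (by simp)]; exact ih _ (Or.inr rfl)

/-- The algorithm decides the length language `{x | |x| = 2^k}`. [folklore] -/
theorem pow2Alg_decides : pow2Alg.Decides {x | ∃ k, x.length = 2 ^ k} := by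
  intro x
  show pow2Alg.accept x.length (x.foldl (pow2Alg.update x.length) (pow2Alg.init x.length)) = true ↔
    ∃ k, x.length = 2 ^ k
  have hinit := pow2Alg_init x.length
  rw [pow2Alg_foldl _ _ _ (by rw [hinit]; split_ifs <;> simp)]
  show accBit ((pow2Alg.init x.length).foldl δ6 q6) = true ↔ _
  rw [accBit_eq, hinit, decide_eq_true_iff]
  have hiff : x.length = 2 ^ Nat.log 2 x.length ↔ ∃ k, x.length = 2 ^ k :=
    ⟨fun h => ⟨_, h⟩, fun ⟨k, hk⟩ => by rw [hk, Nat.log_pow (by norm_num)]⟩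
  rw [← hiff]
  split_ifs with h
  · exact iff_of_true rfl h
  · exact iff_of_false (by simp) h

/-- The algorithm has space `S` for every `S ≥ 1`. [folklore] -/
theorem pow2Alg_hasSpace (S : ℕ → ℕ) (hS : ∀ N, 1 ≤ S N) : pow2Alg.HasSpace S := by
  refine fun N => ⟨?_, fun st b _ => ?_⟩
  · rw [pow2Alg_init]; split_ifs <;> simp [hS N]
  · rw [pow2Alg_update]; split_ifs <;> simp [hS N]

/-- **The uniform streaming class of `UniformStreamLB` is inhabited (every budget `S ≥ log₂ + 1`)**:
ONE init / update / accept machine each, before `∀ N`, with honest step counts, deciding the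
length language `{x | |x| = 2^k}`. [folklore] -/
theorem uniformClass_pow2 (S : ℕ → ℕ) (hS : ∀ N, Nat.log 2 N + 1 ≤ S N) :
    ∃ (A : StreamingAlgorithm) (M₀ M₁ M₂ : TM2ComputableAux Bool Bool),
      A.HasSpace S ∧
      (∀ N : ℕ, M₀.OutputsWithin (encodeNat N) (A.init N) (S N)) ∧
      (∀ (N : ℕ) (st : List Bool) (b : Bool), st.length ≤ S N →
        M₁.OutputsWithin (boolPair st [b]) (A.update N st b) (S N)) ∧
      (∀ (N : ℕ) (st : List Bool), st.length ≤ S N →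
        M₂.OutputsWithin st (encodeBool (A.accept N st)) (S N)) ∧
      A.Decides {x | ∃ k, x.length = 2 ^ k} := by
  have h1 : ∀ N, 1 ≤ S N := fun N => le_trans (Nat.le_add_left 1 _) (hS N)
  refine ⟨pow2Alg, dfaMachine Q3.zeros δpow outInit 1, dfaMachine q6 δ6 outUpd 1,
    dfaMachine q6 δ6 (fun v => [accBit v]) 1, pow2Alg_hasSpace S h1, fun N => ?_,
    fun N st b hst => ?_, fun N st hst => ?_, pow2Alg_decides⟩
  · refine (dfaMachine_outputsWithin Q3.zeros δpow outInit 1 (fun q => ?_) (encodeNat N)).mono ?_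
    · unfold outInit; split_ifs <;> simp
    · have := TM2Pass.length_encodeNat_le N; have := hS N; omega
  · refine (dfaMachine_outputsWithin q6 δ6 outUpd 1 (fun q => ?_) (boolPair st [b])).mono ?_
    · unfold outUpd; split_ifs <;> simp
    · rw [length_boolPair, List.length_singleton]; have := h1 N; omega
  · refine (dfaMachine_outputsWithin q6 δ6 (fun v => [accBit v]) 1 (fun q => by simp) st).mono ?_
    have := h1 N; omega

end Pow2

/-! ### Consequences for `UniformStreamLB`: large size functions are no witnesses -/

section LargeSize

/-- `n ≤ univBound n`. [folklore] -/
theorem le_univBound (n : ℕ) : n ≤ univBound n := by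
  induction n with
  | zero => simp [univBound]
  | succ n ih => simp only [univBound]; omega

/-- **Negative lemma (tightness of the `∃ s`).** No size function `s` dominating the universal
bound `univBound n = 5·2ⁿ - 4` witnesses `UniformStreamLB`: for such `s`, `MCSP[s]` (= all truth
tables) IS decided by a uniform one-pass streaming algorithm within budget `s(⌊log₂N⌋)^1 + 1`
(init: a 3-state automaton on the numeral of `N`; update/accept: 6-symbol absorbers; 8 pops per
`TM2` step, so every machine halts within `|input|/8 + 1 ≤` budget steps). [folklore] -/
theorem uniformStreamLB_matrix_false_of_univBound_le (s : ℕ → ℕ) (hs : ∀ n, univBound n ≤ s n) :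
    ¬ ∀ c : ℕ, ¬ ∃ (A : StreamingAlgorithm) (M₀ M₁ M₂ : TM2ComputableAux Bool Bool),
      A.HasSpace (fun N => s (Nat.log 2 N) ^ c + c) ∧
      (∀ N : ℕ, M₀.OutputsWithin (encodeNat N) (A.init N) (s (Nat.log 2 N) ^ c + c)) ∧
      (∀ (N : ℕ) (st : List Bool) (b : Bool), st.length ≤ s (Nat.log 2 N) ^ c + c →
        M₁.OutputsWithin (boolPair st [b]) (A.update N st b) (s (Nat.log 2 N) ^ c + c)) ∧
      (∀ (N : ℕ) (st : List Bool), st.length ≤ s (Nat.log 2 N) ^ c + c →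
        M₂.OutputsWithin st (encodeBool (A.accept N st)) (s (Nat.log 2 N) ^ c + c)) ∧
      A.Decides (MCSPSize s) := by
  intro h
  refine h 1 ?_
  rw [UniformMagnification.Negative.MCSPSize_eq_setOf_pow_two s hs]
  refine uniformClass_pow2 (fun N => s (Nat.log 2 N) ^ 1 + 1) fun N => ?_
  have := le_univBound (Nat.log 2 N)
  have := hs (Nat.log 2 N)
  simp only [pow_one]
  omega

end LargeSize


/-- **Any witness of `UniformStreamLB` dips below the universal bound**: if `s` witnesses the
crux's matrix then `s n < univBound n = 5·2ⁿ - 4` for some `n`. [folklore] -/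
theorem witness_lt_univBound (s : ℕ → ℕ)
    (h : ∀ c : ℕ, ¬ ∃ (A : StreamingAlgorithm) (M₀ M₁ M₂ : TM2ComputableAux Bool Bool),
      A.HasSpace (fun N => s (Nat.log 2 N) ^ c + c) ∧
      (∀ N : ℕ, M₀.OutputsWithin (encodeNat N) (A.init N) (s (Nat.log 2 N) ^ c + c)) ∧
      (∀ (N : ℕ) (st : List Bool) (b : Bool), st.length ≤ s (Nat.log 2 N) ^ c + c →
        M₁.OutputsWithin (boolPair st [b]) (A.update N st b) (s (Nat.log 2 N) ^ c + c)) ∧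
      (∀ (N : ℕ) (st : List Bool), st.length ≤ s (Nat.log 2 N) ^ c + c →
        M₂.OutputsWithin st (encodeBool (A.accept N st)) (s (Nat.log 2 N) ^ c + c)) ∧
      A.Decides (MCSPSize s)) :
    ∃ n, s n < univBound n := by
  by_contra hlt
  push Not at hlt
  exact uniformStreamLB_matrix_false_of_univBound_le s hlt h

/-- The same, read off the crux BY NAME: `UniformStreamLB` can only be witnessed by a
time-constructible `s` with `s n < univBound n` somewhere. [folklore] -/
theorem uniformStreamLB_witness_shape (h : Summit.PneNP.PneNP.Theses.UniformStream.UniformStreamLB) :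
    ∃ s : ℕ → ℕ, IsTimeConstructible s ∧ (∃ n, s n < univBound n) ∧
      ∀ c : ℕ, ¬ ∃ (A : StreamingAlgorithm) (M₀ M₁ M₂ : TM2ComputableAux Bool Bool),
      A.HasSpace (fun N => s (Nat.log 2 N) ^ c + c) ∧
      (∀ N : ℕ, M₀.OutputsWithin (encodeNat N) (A.init N) (s (Nat.log 2 N) ^ c + c)) ∧
      (∀ (N : ℕ) (st : List Bool) (b : Bool), st.length ≤ s (Nat.log 2 N) ^ c + c →
        M₁.OutputsWithin (boolPair st [b]) (A.update N st b) (s (Nat.log 2 N) ^ c + c)) ∧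
      (∀ (N : ℕ) (st : List Bool), st.length ≤ s (Nat.log 2 N) ^ c + c →
        M₂.OutputsWithin st (encodeBool (A.accept N st)) (s (Nat.log 2 N) ^ c + c)) ∧
      A.Decides (MCSPSize s) := by
  obtain ⟨s, hs, hno⟩ := h
  exact ⟨s, hs, witness_lt_univBound s hno, hno⟩

end Summit.PneNP.PneNP.Theorems.UniformStreamLB.Negative

end
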